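import Literature.Geometry.Kaehler.ComplexTorusIdealIsogenyComposition
import HarnessLib

/-!
# Equivalent ideals of `End(X)` and isomorphic quotients `X/H(I)` (Kieffer 2024 §1.4.1, Proposition 1.4.6)

For a complex torus `X = ComplexTorus Φ` (`Φ : (ι → ℝ) ≃L[ℝ] E`, `End(X) = endRingInt Φ ⊆ M_ι(ℤ)`,
`End⁰(X) = endAlgRat Φ ⊆ M_ι(ℚ)`), left ideals `I, J ⊆ End(X)` with finite kernel subgroups `H(I)`, `H(J)`
(`kernelSubgroup`, `ComplexTorusKernelIdeals`) and the quotient tori `X/H(I)`, `X/H(J)` (`quotientByPeriod`,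
`ComplexTorusQuotientFiniteSubgroup`), we formalize, at torus level:

> "Our stated aim is to span the isogeny class of `A` using isogenies of the above form. Therefore, we should
> study when the codomains `A/H(I)` and `A/H(J)` are isomorphic. We have already seen that if `I` is principal,
> then `A/H(I)` is isomorphic to `A`. More generally, we call two ideals `I` and `J` *equivalent* if `I = Jλ` for
> some `λ ∈ End⁰(A)`; an ideal `I` is principal if and only if it is equivalent to the trivial ideal `End(A)`.
> […]
> **Proposition 1.4.6.** 1. If `I` and `J` are equivalent `End(A)`-ideals, then `A/H(I)` and `A/H(J)` are
> isomorphic as abelian varieties.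
> 2. If `A/H(I) ≃ A/H(J)` and if both `I` and `J` are kernel ideals, then `I` and `J` are equivalent.
> *Proof.* 1. Let `λ ∈ End⁰(A)` such that `I = Jλ`, and fix an integer `N ≥ 1` such that `Nλ ∈ End(A)`. Then
> we have `NI = J(Nλ)`. By Lemma 1.4.4, we can factor `φ_{NI} = φ_{J(Nλ)}` in two different ways:
> `A →[N] A →[φ_I] A/H(I)` and `A →[Nλ] A →[φ_J] A/H(J)`. Thus `A/H(I)` and `A/H(J)`, as codomains of isogenies
> with the same kernel, are isomorphic by Proposition 1.1.11.
> 2. Assume `A/H(I)` and `A/H(J)` are isomorphic; we identify both codomains with a fixed abelian variety `B`.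
> First pick `N ≥ 1` large enough so that `H(J) ⊂ [N]⁻¹H(I) = ker(Nφ_I)`. By isogeny factorization
> (Proposition 1.1.12), there exists an isogeny `ψ : B → B` such that `Nφ_I = ψ ∘ φ_J`. Next, we pick `M ≥ 1`
> large enough such that `Mψ ∘ φ_J = φ_J ∘ α` for some `α ∈ End(A)`: this is possible because
> `φ_J⁻¹ ∘ ψ ∘ φ_J ∈ End⁰(A)`. Then we have `MNφ_I = φ_J ∘ α`, in other words `H(MNI) = H(Jα)`. Thus `MNI = Jα`
> as both are kernel ideals by Lemma 1.4.5, hence `I` and `J` are equivalent." [Kieffer2024IsogenyGraphs, p. 45]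

**Lean rendering and torus-level proofs.**  `IdealEquiv Φ I J` is "`I = Jλ` for some `λ ∈ End⁰(X)`" read on
the images `I_ℚ, J_ℚ ⊆ End⁰(X)` (`idealRat`), with `λ` INVERTIBLE — automatic under Kieffer's standing convention
that ideals are lattices, i.e. contain an isogeny (`idealEquiv_of_idealRat_eq`), and what makes "equivalent" an
equivalence relation (`IdealEquiv.refl/symm/trans`).  Over `ℂ` both halves of Prop. 1.4.6 are statements about
the GLOBAL over-lattices `Λ_I = π⁻¹H(I) = {x : σ_ℝ x ∈ ℤ^ι ∀ σ ∈ I} = Q_{I,ℝ}⁻¹ ℤ^ι`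
(`proj_mem_kernelSubgroup_iff`, `proj_mem_iff_exists_quotientMatrix_mulVec_eq`): (1) `I = Jλ` gives
`Λ_I = λ⁻¹ Λ_J`, so `ρ(Q_J λ Q_I⁻¹)` is an isomorphism `X/H(I) ≅ X/H(J)` with analytic representation
`Φ ∘ λ_ℝ ∘ Φ⁻¹` (`exists_matrix_quotientPeriod` of `ComplexTorusIdealIsogenyComposition` — Kieffer's route
"codomains of isogenies with the same kernel", Prop. 1.1.11, with the two factorisations of Lemma 1.4.4 replaced by
the direct comparison of over-lattices); (2) an isomorphism `X/H(I) ≅ X/H(J)` is `ρ(R)`, `R ∈ GL_ι(ℤ)`, with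
`ℂ`-linear analytic representation (`IsIsomorphic.exists_matrix`, Lange §1.1.6 Ex. (5)), so
`g = Q_J⁻¹ R Q_I ∈ End⁰(X)` is invertible with `g Λ_I = Λ_J`; a kernel ideal is recovered from its over-lattice,
`I = I(H(I)) = {σ ∈ End(X) : σ Λ_I ⊆ ℤ^ι}`, and `τ ↦ τ g` carries `{τ : τ Λ_J ⊆ ℤ^ι}` onto
`{σ : σ Λ_I ⊆ ℤ^ι}` (`exists_mem_idealOfSubgroup_coe_eq_mul`, the transport lemma behind Prop. 1.4.7's
`range_quotientEndHom_le_rightOrder`), i.e. `I = Jg` — Kieffer's "`H(MNI) = H(Jα)`, thus `MNI = Jα` as both are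
kernel ideals" (`IsKernelIdeal.eq_of_kernelSubgroup_eq`) without the detour through `N`, `M`, `ψ`.

## Contents (namespace `Literature.Geometry.Kaehler.ComplexTorus`)

* §1 `idealRat Φ I = I_ℚ`, `mem_idealRat_iff`, `coe_mem_idealRat_iff`; **`IdealEquiv Φ I J`**, `IdealEquiv.refl`,
  `IdealEquiv.symm`, `IdealEquiv.trans`, `idealEquiv_of_idealRat_eq` (the printed "`I = Jλ`, `λ ∈ End⁰(A)`" plus
  an isogeny in `I` give `IdealEquiv`), `idealEquiv_idealMulRight` (`Iα ~ I` for an isogeny `α`),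
  **`idealEquiv_top_iff`** ("`I` is principal if and only if it is equivalent to the trivial ideal `End(A)`").
* §2 `forall_mem_iff_of_idealRat_eq` (`I = Jλ ⟹ (π x ∈ H(I) ⟺ π(λx) ∈ H(J))`, i.e. `Λ_I = λ⁻¹Λ_J`),
  **`IdealEquiv.isIsomorphic_quotient`** (PROP. 1.4.6 (1)), `isIsomorphic_quotient_idealMulRight`
  (`X/H(Iα) ≅ X/H(I)`).
* §3 `exists_mem_idealOfSubgroup_coe_eq_mul` (transport of `I(K)` along `g ∈ End⁰(X)` with `g π⁻¹K₁ ⊆ π⁻¹K₂`),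
  `IsKernelIdeal.eq_of_kernelSubgroup_eq`, **`IsKernelIdeal.idealEquiv_of_isIsomorphic`** (PROP. 1.4.6 (2)),
  **`IsKernelIdeal.idealEquiv_iff_isIsomorphic`**.

No named facts are introduced (definitions with bodies and proved theorems only).

## References

* [Kieffer2024IsogenyGraphs] J. Kieffer, *Isogeny graphs in higher dimensions* (lecture notes, 2024), §1.4.1,
  equivalent ideals and Proposition 1.4.6 with proof (p. 45); Prop. 1.1.11 (p. 10); after W. C. Waterhouse,
  *Abelian varieties over finite fields*, Ann. Sci. ÉNS (4) 2 (1969), §3 (Thm. 3.11).  Restated as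
  "`A/A[I] ≅ A/A[J]` if and only if `I ≅ J` [Waterhouse]" in S. Marseglia et al., *Isogeny graphs of abelian
  varieties and singular ideals in orders* (arXiv:2508.03570), proof of Prop. 6.10, p. 15.
* [Lange2023AbelianVarietiesComplex] H. Lange, *Abelian Varieties over the Complex Numbers*, Springer 2023, §1.1.2
  ("`X/Γ = V/π⁻¹(Γ)`"), §1.1.6 Exercise (5)(b) (isomorphism classes of complex tori).
-/

noncomputable section

open Module Function
open scoped Matrix

namespace Literature.Geometry.Kaehler

namespace ComplexTorus

variable {ι : Type*} [Fintype ι] [DecidableEq ι] {E : Type*} [NormedAddCommGroup E] [NormedSpace ℂ E]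
  (Φ : (ι → ℝ) ≃L[ℝ] E)

/-! ## Casts (plumbing) -/

omit [Fintype ι] [DecidableEq ι] in
/-- `ℤ → ℚ → ℝ` casts of an integer matrix. [folklore] -/
private theorem map_intCast_map_ratCast' (A : Matrix ι ι ℤ) :
    (A.map (Int.cast : ℤ → ℚ)).map (Rat.cast : ℚ → ℝ) = A.map (Int.cast : ℤ → ℝ) :=
  Matrix.ext fun i j ↦ Rat.cast_intCast (A i j)

omit [DecidableEq ι] in
/-- Entrywise cast `ℚ → ℝ` of a product. [folklore] -/
private theorem map_ratCast_mul' (A B : Matrix ι ι ℚ) :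
    (A * B).map (Rat.cast : ℚ → ℝ) = A.map (Rat.cast : ℚ → ℝ) * B.map (Rat.cast : ℚ → ℝ) :=
  Matrix.map_mul (f := Rat.castHom ℝ)

omit [DecidableEq ι] in
/-- Entrywise cast `ℤ → ℚ` of a product. [folklore] -/
private theorem map_intCast_mul_rat' (A B : Matrix ι ι ℤ) :
    (A * B).map (Int.cast : ℤ → ℚ) = A.map (Int.cast : ℤ → ℚ) * B.map (Int.cast : ℤ → ℚ) :=
  Matrix.map_mul (f := Int.castRingHom ℚ)

/-- Entrywise cast `ℚ → ℝ` of the inverse of an invertible rational matrix. [folklore] -/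
private theorem map_ratCast_inv' {g : Matrix ι ι ℚ} (hg : IsUnit g.det) :
    (g⁻¹).map (Rat.cast : ℚ → ℝ) = (g.map (Rat.cast : ℚ → ℝ))⁻¹ :=
  (Matrix.inv_eq_right_inv (by
    rw [← map_ratCast_mul', Matrix.mul_nonsing_inv _ hg, Matrix.map_one Rat.cast Rat.cast_zero Rat.cast_one])).symm

omit [DecidableEq ι] in
/-- A product relation `α_ℚ = σ_ℚ M` read over `ℝ`. [folklore] -/
private theorem map_intCast_eq_mul_map_ratCast' {α σ : Matrix ι ι ℤ} {M : Matrix ι ι ℚ}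
    (h : α.map (Int.cast : ℤ → ℚ) = σ.map (Int.cast : ℤ → ℚ) * M) :
    α.map (Int.cast : ℤ → ℝ) = σ.map (Int.cast : ℤ → ℝ) * M.map (Rat.cast : ℚ → ℝ) := by
  have h' := congrArg (fun N : Matrix ι ι ℚ ↦ N.map (Rat.cast : ℚ → ℝ)) h
  simpa only [map_ratCast_mul', map_intCast_map_ratCast'] using h'

/-- A real matrix whose columns are integer vectors is (the real extension of) an integer matrix. [folklore] -/
private theorem exists_map_intCast_eq_of_mulVec_single' {C : Matrix ι ι ℝ}
    (h : ∀ j, ∃ k : ι → ℤ, C *ᵥ Pi.single j 1 = intVec k) : ∃ R : Matrix ι ι ℤ, R.map (Int.cast : ℤ → ℝ) = C := by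
  choose k hk using h
  refine ⟨Matrix.of fun i j ↦ k j i, Matrix.ext fun i j ↦ ?_⟩
  have hC : (C *ᵥ Pi.single j (1 : ℝ)) i = C i j := by
    simp
  have hij := congrFun (hk j) i
  rw [hC] at hij
  simp only [Matrix.map_apply, Matrix.of_apply, hij, intVec]

/-! ## §1 The rational image `I_ℚ` of an ideal and equivalence of ideals -/

section IdealEquiv

/-- **`I_ℚ ⊆ End⁰(X) ⊆ M_ι(ℚ)`**: the image of a left ideal `I ⊆ End(X)` under `End(X) ⊆ M_ι(ℤ) → M_ι(ℚ)` (the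
set in which "`I = Jλ` for some `λ ∈ End⁰(A)`" is read). [cite: Kieffer2024IsogenyGraphs, §1.4.1 (before Lemma 1.4.5: "we call two ideals `I` and `J` equivalent if `I = Jλ` for some `λ ∈ End⁰(A)`"), p. 45] -/
def idealRat (I : Ideal (endRingInt Φ)) : Set (Matrix ι ι ℚ) :=
  (fun σ : endRingInt Φ ↦ (σ : Matrix ι ι ℤ).map (Int.cast : ℤ → ℚ)) '' (I : Set (endRingInt Φ))

/-- Membership in `I_ℚ`. [cite: Kieffer2024IsogenyGraphs, §1.4.1, p. 45] -/
theorem mem_idealRat_iff {I : Ideal (endRingInt Φ)} {M : Matrix ι ι ℚ} :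
    M ∈ idealRat Φ I ↔ ∃ σ ∈ I, (σ : Matrix ι ι ℤ).map (Int.cast : ℤ → ℚ) = M := by
  simp only [idealRat, Set.mem_image, SetLike.mem_coe]

/-- `σ_ℚ ∈ I_ℚ ↔ σ ∈ I` (`End(X) → M_ι(ℚ)` is injective). [cite: Kieffer2024IsogenyGraphs, §1.4.1, p. 45] -/
theorem coe_mem_idealRat_iff {I : Ideal (endRingInt Φ)} {σ : endRingInt Φ} :
    (σ : Matrix ι ι ℤ).map (Int.cast : ℤ → ℚ) ∈ idealRat Φ I ↔ σ ∈ I := by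
  rw [mem_idealRat_iff]
  constructor
  · rintro ⟨τ, hτ, hτσ⟩
    rwa [← Subtype.ext (Matrix.map_injective (Int.cast_injective (α := ℚ)) hτσ)]
  · exact fun h ↦ ⟨σ, h, rfl⟩

/-- `I_ℚ ⊆ End⁰(X)`. [cite: Kieffer2024IsogenyGraphs, §1.4.1, p. 45] -/
theorem idealRat_subset_endAlgRat (I : Ideal (endRingInt Φ)) : idealRat Φ I ⊆ endAlgRat Φ := by
  rintro _ ⟨σ, -, rfl⟩
  exact (mem_endRingInt_iff Φ).1 σ.2

/-- **Equivalent ideals.** "we call two ideals `I` and `J` *equivalent* if `I = Jλ` for some `λ ∈ End⁰(A)`" — read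
on `I_ℚ, J_ℚ ⊆ End⁰(X) ⊆ M_ι(ℚ)`, with `λ` invertible (so that this is an equivalence relation; for ideals
containing an isogeny — Kieffer's standing convention "we assume that `I` is also a lattice in `End(A)` … This
is equivalent to requiring that `I` contains an isogeny" — invertibility of `λ` is automatic,
`idealEquiv_of_idealRat_eq`). [cite: Kieffer2024IsogenyGraphs, §1.4.1 (before Lemma 1.4.5), p. 45] -/
def IdealEquiv (I J : Ideal (endRingInt Φ)) : Prop :=
  ∃ L : Matrix ι ι ℚ, L ∈ endAlgRat Φ ∧ IsUnit L.det ∧ idealRat Φ I = (· * L) '' idealRat Φ J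

/-- Unfolding `IdealEquiv`. [cite: Kieffer2024IsogenyGraphs, §1.4.1, p. 45] -/
theorem idealEquiv_iff {I J : Ideal (endRingInt Φ)} :
    IdealEquiv Φ I J ↔ ∃ L : Matrix ι ι ℚ, L ∈ endAlgRat Φ ∧ IsUnit L.det ∧ idealRat Φ I = (· * L) '' idealRat Φ J :=
  Iff.rfl

/-- `I ~ I` (`λ = 1`). [cite: Kieffer2024IsogenyGraphs, §1.4.1, p. 45] -/
theorem IdealEquiv.refl (I : Ideal (endRingInt Φ)) : IdealEquiv Φ I I :=
  ⟨1, Subalgebra.one_mem _, by rw [Matrix.det_one]; exact isUnit_one, by simp⟩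

variable {Φ}

/-- `I ~ J ⟹ J ~ I` (`λ ↦ λ⁻¹`). [cite: Kieffer2024IsogenyGraphs, §1.4.1, p. 45] -/
theorem IdealEquiv.symm {I J : Ideal (endRingInt Φ)} (h : IdealEquiv Φ I J) : IdealEquiv Φ J I := by
  obtain ⟨L, hL, hLu, hIJ⟩ := h
  refine ⟨L⁻¹, inv_mem_endAlgRat Φ hL, Matrix.isUnit_nonsing_inv_det L hLu, ?_⟩
  rw [hIJ, Set.image_image]
  conv_lhs => rw [← Set.image_id (idealRat Φ J)]
  exact Set.image_congr' fun M ↦ (Matrix.mul_nonsing_inv_cancel_right L M hLu).symm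

/-- `I ~ J ~ K ⟹ I ~ K` (`λ, λ′ ↦ λ′λ`). [cite: Kieffer2024IsogenyGraphs, §1.4.1, p. 45] -/
theorem IdealEquiv.trans {I J K : Ideal (endRingInt Φ)} (h₁ : IdealEquiv Φ I J) (h₂ : IdealEquiv Φ J K) :
    IdealEquiv Φ I K := by
  obtain ⟨L, hL, hLu, hIJ⟩ := h₁
  obtain ⟨L', hL', hL'u, hJK⟩ := h₂
  refine ⟨L' * L, (endAlgRat Φ).mul_mem hL' hL, by rw [Matrix.det_mul]; exact hL'u.mul hLu, ?_⟩
  rw [hIJ, hJK, Set.image_image]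
  exact Set.image_congr' fun M ↦ Matrix.mul_assoc M L' L

variable (Φ)

/-- **The printed condition plus the standing convention give `IdealEquiv`**: if `I_ℚ = J_ℚ λ` for some
`λ ∈ End⁰(X)` and `I` contains an isogeny (`det σ₀ ≠ 0`), then `λ` is invertible (`σ₀ = τλ` forces
`det λ ≠ 0`). [cite: Kieffer2024IsogenyGraphs, §1.4.1 ("we assume that `I` … contains an isogeny"; "`I = Jλ` for some `λ ∈ End⁰(A)`"), pp. 43, 45] -/
theorem idealEquiv_of_idealRat_eq {I J : Ideal (endRingInt Φ)} {L : Matrix ι ι ℚ} (hL : L ∈ endAlgRat Φ)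
    (h : idealRat Φ I = (· * L) '' idealRat Φ J) {σ₀ : endRingInt Φ} (hσ₀ : σ₀ ∈ I)
    (hdet : (σ₀ : Matrix ι ι ℤ).det ≠ 0) : IdealEquiv Φ I J := by
  refine ⟨L, hL, ?_, h⟩
  have hmem : (σ₀ : Matrix ι ι ℤ).map (Int.cast : ℤ → ℚ) ∈ (· * L) '' idealRat Φ J := h ▸ (coe_mem_idealRat_iff Φ).2 hσ₀
  obtain ⟨M, -, hM⟩ := hmem
  have hd : ((σ₀ : Matrix ι ι ℤ).det : ℚ) = M.det * L.det := by
    rw [Int.cast_det, ← hM, Matrix.det_mul]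
  exact isUnit_iff_ne_zero.2 fun h0 ↦ (Int.cast_ne_zero.2 hdet) (by rw [hd, h0, mul_zero])

/-- **`Iα ~ I` for an isogeny `α ∈ End(X)`** (`λ = α`; `Iα = idealMulRight Φ I α` of Lemma 1.4.5).
[cite: Kieffer2024IsogenyGraphs, §1.4.1 (equivalent ideals; Lemma 1.4.5), p. 45] -/
theorem idealEquiv_idealMulRight (I : Ideal (endRingInt Φ)) {α : endRingInt Φ} (hα : (α : Matrix ι ι ℤ).det ≠ 0) :
    IdealEquiv Φ (idealMulRight Φ I α) I := by
  refine ⟨(α : Matrix ι ι ℤ).map (Int.cast : ℤ → ℚ), (mem_endRingInt_iff Φ).1 α.2, ?_, ?_⟩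
  · rw [← Int.cast_det]
    exact (Int.cast_ne_zero.2 hα).isUnit
  · ext M
    simp only [mem_idealRat_iff, Set.mem_image, mem_idealMulRight_iff]
    constructor
    · rintro ⟨_, ⟨β, hβ, rfl⟩, rfl⟩
      exact ⟨_, ⟨β, hβ, rfl⟩, by rw [Subring.coe_mul, map_intCast_mul_rat']⟩
    · rintro ⟨_, ⟨β, hβ, rfl⟩, rfl⟩
      exact ⟨β * α, ⟨β, hβ, rfl⟩, by rw [Subring.coe_mul, map_intCast_mul_rat']⟩

/-- **"an ideal `I` is principal if and only if it is equivalent to the trivial ideal `End(A)`"** (for ideals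
containing an isogeny: the generator is then an isogeny). [cite: Kieffer2024IsogenyGraphs, §1.4.1 (before Lemma 1.4.5), p. 45] -/
theorem idealEquiv_top_iff {I : Ideal (endRingInt Φ)} :
    IdealEquiv Φ I ⊤ ↔ ∃ α : endRingInt Φ, (α : Matrix ι ι ℤ).det ≠ 0 ∧ I = Ideal.span {α} := by
  constructor
  · rintro ⟨L, -, hLu, hI⟩
    -- `L = 1 · L ∈ I_ℚ` is integral: `L = α_ℚ` with `α ∈ I`
    have hLmem : L ∈ idealRat Φ I := by
      rw [hI]
      refine ⟨1, ?_, Matrix.one_mul L⟩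
      have h1 := (coe_mem_idealRat_iff Φ (I := ⊤) (σ := 1)).2 Submodule.mem_top
      rwa [OneMemClass.coe_one, Matrix.map_one Int.cast Int.cast_zero Int.cast_one] at h1
    obtain ⟨α, hαI, hαL⟩ := (mem_idealRat_iff Φ).1 hLmem
    refine ⟨α, ?_, le_antisymm (fun σ hσ ↦ ?_) ((Ideal.span_singleton_le_iff_mem _).2 hαI)⟩
    · rw [← hαL, ← Int.cast_det] at hLu
      exact Int.cast_ne_zero.1 hLu.ne_zero
    · -- `σ_ℚ = β_ℚ L = (βα)_ℚ`
      have hσ' : (σ : Matrix ι ι ℤ).map (Int.cast : ℤ → ℚ) ∈ (· * L) '' idealRat Φ ⊤ :=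
        hI ▸ (coe_mem_idealRat_iff Φ).2 hσ
      obtain ⟨_, ⟨β, -, rfl⟩, hβ⟩ := hσ'
      dsimp only at hβ
      rw [← hαL, ← map_intCast_mul_rat', ← Subring.coe_mul] at hβ
      exact Ideal.mem_span_singleton'.2 ⟨β, Subtype.ext (Matrix.map_injective (Int.cast_injective (α := ℚ)) hβ)⟩
  · rintro ⟨α, hα, rfl⟩
    have h := idealEquiv_idealMulRight Φ ⊤ hα
    rwa [show idealMulRight Φ ⊤ α = Ideal.span {α} from ?_] at h
    ext μ
    rw [mem_idealMulRight_iff, Ideal.mem_span_singleton']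
    exact ⟨fun ⟨β, _, h⟩ ↦ ⟨β, h⟩, fun ⟨β, h⟩ ↦ ⟨β, Submodule.mem_top, h⟩⟩

end IdealEquiv

/-! ## §2 Proposition 1.4.6 (1): equivalent ideals have isomorphic quotients -/

section Prop146a

/-- **`I = Jλ ⟹ Λ_I = λ_ℝ⁻¹ Λ_J`**: if `I_ℚ = J_ℚ λ` then, for every `x ∈ ℝ^ι`, `σ_ℝ x ∈ ℤ^ι` for all `σ ∈ I`
iff `τ_ℝ (λ_ℝ x) ∈ ℤ^ι` for all `τ ∈ J` (`(τλ)_ℝ = τ_ℝ λ_ℝ`) — the over-lattice comparison behind "`NI = J(Nλ)` …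
`φ_{NI} = φ_{J(Nλ)}` … isogenies with the same kernel".
[cite: Kieffer2024IsogenyGraphs, §1.4.1 Prop. 1.4.6 (1) (proof), p. 45] -/
theorem forall_mem_iff_of_idealRat_eq {I J : Ideal (endRingInt Φ)} {L : Matrix ι ι ℚ}
    (h : idealRat Φ I = (· * L) '' idealRat Φ J) (x : ι → ℝ) :
    (∀ σ ∈ I, ∃ n : ι → ℤ, (σ : Matrix ι ι ℤ).map (Int.cast : ℤ → ℝ) *ᵥ x = intVec n) ↔
      ∀ τ ∈ J, ∃ n : ι → ℤ,
        (τ : Matrix ι ι ℤ).map (Int.cast : ℤ → ℝ) *ᵥ (L.map (Rat.cast : ℚ → ℝ) *ᵥ x) = intVec n := by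
  constructor
  · intro hI τ hτ
    -- `τλ = σ` for some `σ ∈ I`
    have hmem : (τ : Matrix ι ι ℤ).map (Int.cast : ℤ → ℚ) * L ∈ idealRat Φ I :=
      h ▸ ⟨_, (coe_mem_idealRat_iff Φ).2 hτ, rfl⟩
    obtain ⟨σ, hσ, hσe⟩ := (mem_idealRat_iff Φ).1 hmem
    obtain ⟨n, hn⟩ := hI σ hσ
    exact ⟨n, by rw [Matrix.mulVec_mulVec, ← map_intCast_eq_mul_map_ratCast' hσe, hn]⟩
  · intro hJ σ hσ
    -- `σ = τλ` for some `τ ∈ J`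
    have hmem : (σ : Matrix ι ι ℤ).map (Int.cast : ℤ → ℚ) ∈ (· * L) '' idealRat Φ J :=
      h ▸ (coe_mem_idealRat_iff Φ).2 hσ
    obtain ⟨_, ⟨τ, hτ, rfl⟩, hτσ⟩ := hmem
    obtain ⟨n, hn⟩ := hJ τ hτ
    exact ⟨n, by rw [map_intCast_eq_mul_map_ratCast' hτσ.symm, ← Matrix.mulVec_mulVec, hn]⟩

/-- The same on the torus: **`π(x) ∈ H(I) ⟺ π(λ_ℝ x) ∈ H(J)`** when `I_ℚ = J_ℚ λ`.
[cite: Kieffer2024IsogenyGraphs, §1.4.1 Prop. 1.4.6 (1) (proof), p. 45] -/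
theorem proj_mem_kernelSubgroup_iff_of_idealRat_eq {I J : Ideal (endRingInt Φ)} {L : Matrix ι ι ℚ}
    (h : idealRat Φ I = (· * L) '' idealRat Φ J) (x : ι → ℝ) :
    proj Φ x ∈ kernelSubgroup Φ I ↔ proj Φ (L.map (Rat.cast : ℚ → ℝ) *ᵥ x) ∈ kernelSubgroup Φ J := by
  rw [proj_mem_kernelSubgroup_iff, proj_mem_kernelSubgroup_iff, forall_mem_iff_of_idealRat_eq Φ h x]

variable {Φ}

/-- **PROPOSITION 1.4.6 (1). "If `I` and `J` are equivalent `End(A)`-ideals, then `A/H(I)` and `A/H(J)` are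
isomorphic as abelian varieties."** At torus level: `X/H(I) ≅ X/H(J)` as complex tori (`IsIsomorphic`), by
`ρ(Q_J λ Q_I⁻¹)` with analytic representation `Φ ∘ λ_ℝ ∘ Φ⁻¹` — `λ_ℝ` carries the over-lattice
`Λ_I = π⁻¹H(I) = Q_{I,ℝ}⁻¹ℤ^ι` onto `Λ_J` (`exists_matrix_quotientPeriod`).
[cite: Kieffer2024IsogenyGraphs, §1.4.1 Prop. 1.4.6 (1), p. 45] -/
theorem IdealEquiv.isIsomorphic_quotient {I J : Ideal (endRingInt Φ)} (h : IdealEquiv Φ I J)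
    [Finite (kernelSubgroup Φ I)] [Finite (kernelSubgroup Φ J)] :
    IsIsomorphic (quotientByPeriod Φ (kernelSubgroup Φ I)) (quotientByPeriod Φ (kernelSubgroup Φ J)) := by
  obtain ⟨L, hL, hLu, hIJ⟩ := h
  refine isIsomorphic_quotientPeriod_of_endAlgRat Φ (det_quotientMatrix_ne_zero Φ _)
    (det_quotientMatrix_ne_zero Φ _) hL hLu fun x ↦ ?_
  rw [← proj_mem_iff_exists_quotientMatrix_mulVec_eq, ← proj_mem_iff_exists_quotientMatrix_mulVec_eq]
  exact proj_mem_kernelSubgroup_iff_of_idealRat_eq Φ hIJ x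

/-- Prop. 1.4.6 (1), matrix form: for `I ~ J` via `λ` there is `R ∈ GL_ι(ℤ)` (`R = Q_J λ Q_I⁻¹`,
`R · Q_I = Q_J · λ`) with `ℂ`-linear analytic representation `C = Φ ∘ λ_ℝ ∘ Φ⁻¹`, `Φ_J ∘ R_ℝ = C ∘ Φ_I` — an
isomorphism `ρ(R) : X/H(I) ≅ X/H(J)` with `ρ(R) ∘ φ_I = φ_J ∘ ρ(λ)` rationally.
[cite: Kieffer2024IsogenyGraphs, §1.4.1 Prop. 1.4.6 (1), p. 45] -/
theorem IdealEquiv.exists_matrix_quotient {I J : Ideal (endRingInt Φ)} (h : IdealEquiv Φ I J)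
    [Finite (kernelSubgroup Φ I)] [Finite (kernelSubgroup Φ J)] :
    ∃ (L : Matrix ι ι ℚ) (R R' : Matrix ι ι ℤ) (C : E →L[ℂ] E), L ∈ endAlgRat Φ ∧ IsUnit L.det ∧
      idealRat Φ I = (· * L) '' idealRat Φ J ∧ R' * R = 1 ∧ R * R' = 1 ∧
      (∀ y, quotientByPeriod Φ (kernelSubgroup Φ J) (R.map (Int.cast : ℤ → ℝ) *ᵥ y) =
        C (quotientByPeriod Φ (kernelSubgroup Φ I) y)) ∧
      (∀ x, C (Φ x) = Φ (L.map (Rat.cast : ℚ → ℝ) *ᵥ x)) ∧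
      R.map (Int.cast : ℤ → ℚ) * quotientMatrixRat Φ (kernelSubgroup Φ I) =
        quotientMatrixRat Φ (kernelSubgroup Φ J) * L := by
  obtain ⟨L, hL, hLu, hIJ⟩ := h
  obtain ⟨R, R', C, hR'R, hRR', hC, hCΦ, hRQ⟩ := exists_matrix_quotientPeriod Φ (det_quotientMatrix_ne_zero Φ _)
    (det_quotientMatrix_ne_zero Φ (kernelSubgroup Φ J)) hL hLu fun x ↦ by
      rw [← proj_mem_iff_exists_quotientMatrix_mulVec_eq, ← proj_mem_iff_exists_quotientMatrix_mulVec_eq]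
      exact proj_mem_kernelSubgroup_iff_of_idealRat_eq Φ hIJ x
  exact ⟨L, R, R', C, hL, hLu, hIJ, hR'R, hRR', hC, hCΦ, hRQ⟩

variable (Φ)

/-- **`X/H(Iα) ≅ X/H(I)`** for an isogeny `α ∈ End(X)` (`Iα ~ I`; with `H(Iα) = α⁻¹H(I)`,
`kernelSubgroup_idealMulRight`). [cite: Kieffer2024IsogenyGraphs, §1.4.1 Lemma 1.4.5 and Prop. 1.4.6 (1), p. 45] -/
theorem isIsomorphic_quotient_idealMulRight (I : Ideal (endRingInt Φ)) {α : endRingInt Φ}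
    (hα : (α : Matrix ι ι ℤ).det ≠ 0) [Finite (kernelSubgroup Φ (idealMulRight Φ I α))]
    [Finite (kernelSubgroup Φ I)] :
    IsIsomorphic (quotientByPeriod Φ (kernelSubgroup Φ (idealMulRight Φ I α)))
      (quotientByPeriod Φ (kernelSubgroup Φ I)) :=
  (idealEquiv_idealMulRight Φ I hα).isIsomorphic_quotient

end Prop146a

/-! ## §3 Proposition 1.4.6 (2): isomorphic quotients of kernel ideals are equivalent -/

section Prop146b

/-- **Transport of `I(K)` along `g ∈ End⁰(X)`**: if `g_ℝ` maps `π⁻¹K₁` into `π⁻¹K₂`, then for every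
`τ ∈ I(K₂)` the rational matrix `τ·g` is `σ_ℚ` for some `σ ∈ I(K₁)` — it is integral (its columns
`τ_ℝ(g_ℝ eⱼ)` are lattice vectors since `π(g_ℝ eⱼ) ∈ K₂ ⊆ Ker τ`), lies in `End⁰(X)`, and kills `K₁`
(`π x ∈ K₁ ⟹ π(g_ℝ x) ∈ K₂ ⟹ τ_ℝ g_ℝ x ∈ ℤ^ι`). (The argument of Prop. 1.4.7, "`V_ℓ(σα)(T_ℓ(A)) ⊂ T_ℓ(A)`, so
`σα ∈ End(A)`", for a general `g`.) [cite: Kieffer2024IsogenyGraphs, §1.4.1 Prop. 1.4.6 (2) and Prop. 1.4.7 (proofs), pp. 45–46] -/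
theorem exists_mem_idealOfSubgroup_coe_eq_mul {K₁ K₂ : AddSubgroup (ComplexTorus Φ)} {g : Matrix ι ι ℚ}
    (hg : g ∈ endAlgRat Φ) (hK : ∀ x : ι → ℝ, proj Φ x ∈ K₁ → proj Φ (g.map (Rat.cast : ℚ → ℝ) *ᵥ x) ∈ K₂)
    {τ : endRingInt Φ} (hτ : τ ∈ idealOfSubgroup Φ K₂) :
    ∃ σ ∈ idealOfSubgroup Φ K₁, (σ : Matrix ι ι ℤ).map (Int.cast : ℤ → ℚ) =
      (τ : Matrix ι ι ℤ).map (Int.cast : ℤ → ℚ) * g := by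
  rw [mem_idealOfSubgroup_iff] at hτ
  -- `τ_ℝ (g_ℝ x) ∈ ℤ^ι` whenever `π(x) ∈ K₁`
  have hint : ∀ x : ι → ℝ, proj Φ x ∈ K₁ → ∃ k : ι → ℤ,
      (τ : Matrix ι ι ℤ).map (Int.cast : ℤ → ℝ) *ᵥ (g.map (Rat.cast : ℚ → ℝ) *ᵥ x) = intVec k := fun x hx ↦
    (proj_mem_ker_mapMatrixHom_iff Φ Φ (τ : Matrix ι ι ℤ) _).1 (hτ (hK x hx))
  -- the integer matrix `σ` with `σ_ℝ = τ_ℝ g_ℝ` (columns at `x = eⱼ`, `π(eⱼ) = 0 ∈ K₁`)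
  obtain ⟨σ, hσ⟩ : ∃ σ : Matrix ι ι ℤ, σ.map (Int.cast : ℤ → ℝ) =
      (τ : Matrix ι ι ℤ).map (Int.cast : ℤ → ℝ) * g.map (Rat.cast : ℚ → ℝ) := by
    refine exists_map_intCast_eq_of_mulVec_single' fun j ↦ ?_
    obtain ⟨k, hk⟩ := hint (Pi.single j 1) (by rw [← intVec_single, proj_intVec]; exact K₁.zero_mem)
    exact ⟨k, by rw [← Matrix.mulVec_mulVec, hk]⟩
  have hσq : σ.map (Int.cast : ℤ → ℚ) = (τ : Matrix ι ι ℤ).map (Int.cast : ℤ → ℚ) * g :=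
    Matrix.map_injective (Rat.cast_injective (α := ℝ)) (by
      change (σ.map (Int.cast : ℤ → ℚ)).map (Rat.cast : ℚ → ℝ) =
        ((τ : Matrix ι ι ℤ).map (Int.cast : ℤ → ℚ) * g).map (Rat.cast : ℚ → ℝ)
      rw [map_ratCast_mul', map_intCast_map_ratCast', map_intCast_map_ratCast', hσ])
  have hσend : σ ∈ endRingInt Φ := by
    rw [mem_endRingInt_iff, hσq]
    exact (endAlgRat Φ).mul_mem ((mem_endRingInt_iff Φ).1 τ.2) hg
  refine ⟨⟨σ, hσend⟩, ?_, hσq⟩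
  rw [mem_idealOfSubgroup_iff]
  intro t ht
  rw [← proj_lift Φ t] at ht ⊢
  obtain ⟨k, hk⟩ := hint _ ht
  exact (proj_mem_ker_mapMatrixHom_iff Φ Φ σ _).2 ⟨k, by rw [hσ, ← Matrix.mulVec_mulVec, hk]⟩

variable {Φ}

/-- **"`H(MNI) = H(Jα)`. Thus `MNI = Jα` as both are kernel ideals"**: kernel ideals with the same kernel
subgroup are equal (`I = I(H(I))`). [cite: Kieffer2024IsogenyGraphs, §1.4.1 Prop. 1.4.6 (2) (proof), p. 45] -/
theorem IsKernelIdeal.eq_of_kernelSubgroup_eq {I J : Ideal (endRingInt Φ)} (hI : IsKernelIdeal Φ I)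
    (hJ : IsKernelIdeal Φ J) (h : kernelSubgroup Φ I = kernelSubgroup Φ J) : I = J := by
  rw [← hI, ← hJ, h]

/-- **PROPOSITION 1.4.6 (2). "If `A/H(I) ≃ A/H(J)` and if both `I` and `J` are kernel ideals, then `I` and `J`
are equivalent."** At torus level: an isomorphism `X/H(I) ≅ X/H(J)` of complex tori is `ρ(R)` for some
`R ∈ GL_ι(ℤ)` with `ℂ`-linear analytic representation `C` (`IsIsomorphic.exists_matrix`); then
`g = Q_J⁻¹ R Q_I ∈ End⁰(X)` (its analytic representation is `C`) is invertible, `g_ℝ` carries `Λ_I = π⁻¹H(I)`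
into `Λ_J` and `g_ℝ⁻¹` carries `Λ_J` into `Λ_I`; since `I = I(H(I))` and `J = I(H(J))`, transporting along `g`
and `g⁻¹` (`exists_mem_idealOfSubgroup_coe_eq_mul`) gives `I_ℚ = J_ℚ g`.
[cite: Kieffer2024IsogenyGraphs, §1.4.1 Prop. 1.4.6 (2), p. 45] -/
theorem IsKernelIdeal.idealEquiv_of_isIsomorphic {I J : Ideal (endRingInt Φ)} (hI : IsKernelIdeal Φ I)
    (hJ : IsKernelIdeal Φ J) [Finite (kernelSubgroup Φ I)] [Finite (kernelSubgroup Φ J)]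
    (h : IsIsomorphic (quotientByPeriod Φ (kernelSubgroup Φ I)) (quotientByPeriod Φ (kernelSubgroup Φ J))) :
    IdealEquiv Φ I J := by
  obtain ⟨R, R', C, hR'R, hRR', hC⟩ := h.exists_matrix
  have huI := isUnit_det_quotientMatrixRat Φ (kernelSubgroup Φ I)
  have huJ := isUnit_det_quotientMatrixRat Φ (kernelSubgroup Φ J)
  -- `g = Q_J⁻¹ R Q_I`, `g′ = Q_I⁻¹ R′ Q_J`
  obtain ⟨g, hg⟩ : ∃ g : Matrix ι ι ℚ, g = (quotientMatrixRat Φ (kernelSubgroup Φ J))⁻¹ *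
      (R.map (Int.cast : ℤ → ℚ) * quotientMatrixRat Φ (kernelSubgroup Φ I)) := ⟨_, rfl⟩
  obtain ⟨g', hg'⟩ : ∃ g' : Matrix ι ι ℚ, g' = (quotientMatrixRat Φ (kernelSubgroup Φ I))⁻¹ *
      (R'.map (Int.cast : ℤ → ℚ) * quotientMatrixRat Φ (kernelSubgroup Φ J)) := ⟨_, rfl⟩
  have hQg : quotientMatrixRat Φ (kernelSubgroup Φ J) * g = R.map (Int.cast : ℤ → ℚ) *
      quotientMatrixRat Φ (kernelSubgroup Φ I) := by
    rw [hg, Matrix.mul_nonsing_inv_cancel_left _ _ huJ]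
  have hQg' : quotientMatrixRat Φ (kernelSubgroup Φ I) * g' = R'.map (Int.cast : ℤ → ℚ) *
      quotientMatrixRat Φ (kernelSubgroup Φ J) := by
    rw [hg', Matrix.mul_nonsing_inv_cancel_left _ _ huI]
  have hgg' : g * g' = 1 := by
    rw [hg, hg']
    calc (quotientMatrixRat Φ (kernelSubgroup Φ J))⁻¹ * (R.map (Int.cast : ℤ → ℚ) * quotientMatrixRat Φ (kernelSubgroup Φ I)) *
          ((quotientMatrixRat Φ (kernelSubgroup Φ I))⁻¹ * (R'.map (Int.cast : ℤ → ℚ) * quotientMatrixRat Φ (kernelSubgroup Φ J)))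
        = (quotientMatrixRat Φ (kernelSubgroup Φ J))⁻¹ * (R.map (Int.cast : ℤ → ℚ) *
            (quotientMatrixRat Φ (kernelSubgroup Φ I) * ((quotientMatrixRat Φ (kernelSubgroup Φ I))⁻¹ *
              (R'.map (Int.cast : ℤ → ℚ) * quotientMatrixRat Φ (kernelSubgroup Φ J))))) := by
          simp only [Matrix.mul_assoc]
      _ = 1 := by
          rw [Matrix.mul_nonsing_inv_cancel_left _ _ huI, ← Matrix.mul_assoc (R.map (Int.cast : ℤ → ℚ)),
            ← map_intCast_mul_rat', hRR', Matrix.map_one Int.cast Int.cast_zero Int.cast_one, Matrix.one_mul,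
            Matrix.nonsing_inv_mul _ huJ]
  have hg'g : g' * g = 1 := by
    rw [hg, hg']
    calc (quotientMatrixRat Φ (kernelSubgroup Φ I))⁻¹ * (R'.map (Int.cast : ℤ → ℚ) * quotientMatrixRat Φ (kernelSubgroup Φ J)) *
          ((quotientMatrixRat Φ (kernelSubgroup Φ J))⁻¹ * (R.map (Int.cast : ℤ → ℚ) * quotientMatrixRat Φ (kernelSubgroup Φ I)))
        = (quotientMatrixRat Φ (kernelSubgroup Φ I))⁻¹ * (R'.map (Int.cast : ℤ → ℚ) *
            (quotientMatrixRat Φ (kernelSubgroup Φ J) * ((quotientMatrixRat Φ (kernelSubgroup Φ J))⁻¹ *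
              (R.map (Int.cast : ℤ → ℚ) * quotientMatrixRat Φ (kernelSubgroup Φ I))))) := by
          simp only [Matrix.mul_assoc]
      _ = 1 := by
          rw [Matrix.mul_nonsing_inv_cancel_left _ _ huJ, ← Matrix.mul_assoc (R'.map (Int.cast : ℤ → ℚ)),
            ← map_intCast_mul_rat', hR'R, Matrix.map_one Int.cast Int.cast_zero Int.cast_one, Matrix.one_mul,
            Matrix.nonsing_inv_mul _ huI]
  have hgu : IsUnit g.det := Matrix.isUnit_det_of_right_inverse hgg'
  -- real forms: `Q_{J,ℝ} g_ℝ = R_ℝ Q_{I,ℝ}`, `Q_{I,ℝ} g′_ℝ = R′_ℝ Q_{J,ℝ}`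
  have hQgr : (quotientMatrix Φ (kernelSubgroup Φ J)).map (Int.cast : ℤ → ℝ) * g.map (Rat.cast : ℚ → ℝ) =
      R.map (Int.cast : ℤ → ℝ) * (quotientMatrix Φ (kernelSubgroup Φ I)).map (Int.cast : ℤ → ℝ) := by
    have h' := congrArg (fun N : Matrix ι ι ℚ ↦ N.map (Rat.cast : ℚ → ℝ)) hQg
    simpa only [map_ratCast_mul', map_intCast_map_ratCast'] using h'
  have hQg'r : (quotientMatrix Φ (kernelSubgroup Φ I)).map (Int.cast : ℤ → ℝ) * g'.map (Rat.cast : ℚ → ℝ) =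
      R'.map (Int.cast : ℤ → ℝ) * (quotientMatrix Φ (kernelSubgroup Φ J)).map (Int.cast : ℤ → ℝ) := by
    have h' := congrArg (fun N : Matrix ι ι ℚ ↦ N.map (Rat.cast : ℚ → ℝ)) hQg'
    simpa only [map_ratCast_mul', map_intCast_map_ratCast'] using h'
  -- the analytic representation of `g` is `C`: `Φ (g_ℝ x) = Φ_J (Q_J g_ℝ x) = Φ_J (R Q_I x) = C (Φ_I (Q_I x)) = C (Φ x)`
  have hΦg : ∀ x : ι → ℝ, Φ (g.map (Rat.cast : ℚ → ℝ) *ᵥ x) = C (Φ x) := fun x ↦ by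
    rw [← quotientPeriod_mulVec Φ (quotientMatrix Φ (kernelSubgroup Φ J)) (det_quotientMatrix_ne_zero Φ _)
      (g.map (Rat.cast : ℚ → ℝ) *ᵥ x), Matrix.mulVec_mulVec, hQgr, ← Matrix.mulVec_mulVec, hC, quotientPeriod_mulVec]
  have hgend : g ∈ endAlgRat Φ := (mem_endAlgRat_iff_mulVec Φ g).2 fun x ↦ Φ.injective (by
    rw [hΦg, apply_latticeJ, apply_latticeJ, hΦg, ContinuousLinearEquiv.map_smul])
  have hg'end : g' ∈ endAlgRat Φ := by
    rw [← Matrix.inv_eq_right_inv hgg']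
    exact inv_mem_endAlgRat Φ hgend
  -- `g_ℝ` maps `π⁻¹H(I)` into `π⁻¹H(J)`, `g′_ℝ` maps `π⁻¹H(J)` into `π⁻¹H(I)`
  have hK : ∀ x : ι → ℝ, proj Φ x ∈ kernelSubgroup Φ I →
      proj Φ (g.map (Rat.cast : ℚ → ℝ) *ᵥ x) ∈ kernelSubgroup Φ J := fun x hx ↦ by
    rw [proj_mem_iff_exists_quotientMatrix_mulVec_eq] at hx ⊢
    obtain ⟨n, hn⟩ := hx
    exact ⟨R *ᵥ n, by rw [Matrix.mulVec_mulVec, hQgr, ← Matrix.mulVec_mulVec, hn, intVec_mulVec]⟩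
  have hK' : ∀ x : ι → ℝ, proj Φ x ∈ kernelSubgroup Φ J →
      proj Φ (g'.map (Rat.cast : ℚ → ℝ) *ᵥ x) ∈ kernelSubgroup Φ I := fun x hx ↦ by
    rw [proj_mem_iff_exists_quotientMatrix_mulVec_eq] at hx ⊢
    obtain ⟨n, hn⟩ := hx
    exact ⟨R' *ᵥ n, by rw [Matrix.mulVec_mulVec, hQg'r, ← Matrix.mulVec_mulVec, hn, intVec_mulVec]⟩
  refine ⟨g, hgend, hgu, Set.ext fun M ↦ ⟨fun hM ↦ ?_, fun hM ↦ ?_⟩⟩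
  · -- `σ ∈ I = I(H(I))` transported along `g′` gives `τ ∈ I(H(J)) = J` with `τ = σ g′`, so `σ = τ g`
    obtain ⟨σ, hσ, rfl⟩ := (mem_idealRat_iff Φ).1 hM
    rw [← hI] at hσ
    obtain ⟨τ, hτ, hτe⟩ := exists_mem_idealOfSubgroup_coe_eq_mul Φ hg'end hK' hσ
    rw [hJ] at hτ
    exact ⟨_, (coe_mem_idealRat_iff Φ).2 hτ, by
      change (τ : Matrix ι ι ℤ).map (Int.cast : ℤ → ℚ) * g = _
      rw [hτe, Matrix.mul_assoc, hg'g, Matrix.mul_one]⟩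
  · -- `τ ∈ J = I(H(J))` transported along `g` gives `σ ∈ I(H(I)) = I` with `σ = τ g`
    obtain ⟨_, hτM, rfl⟩ := hM
    obtain ⟨τ, hτ, rfl⟩ := (mem_idealRat_iff Φ).1 hτM
    rw [← hJ] at hτ
    obtain ⟨σ, hσ, hσe⟩ := exists_mem_idealOfSubgroup_coe_eq_mul Φ hgend hK hτ
    rw [hI] at hσ
    exact (mem_idealRat_iff Φ).2 ⟨σ, hσ, hσe⟩

/-- **PROPOSITION 1.4.6 for kernel ideals: `I ~ J ⟺ X/H(I) ≅ X/H(J)`.**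
[cite: Kieffer2024IsogenyGraphs, §1.4.1 Prop. 1.4.6, p. 45] -/
theorem IsKernelIdeal.idealEquiv_iff_isIsomorphic {I J : Ideal (endRingInt Φ)} (hI : IsKernelIdeal Φ I)
    (hJ : IsKernelIdeal Φ J) [Finite (kernelSubgroup Φ I)] [Finite (kernelSubgroup Φ J)] :
    IdealEquiv Φ I J ↔
      IsIsomorphic (quotientByPeriod Φ (kernelSubgroup Φ I)) (quotientByPeriod Φ (kernelSubgroup Φ J)) :=
  ⟨fun h ↦ h.isIsomorphic_quotient, hI.idealEquiv_of_isIsomorphic hJ⟩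

end Prop146b

end ComplexTorus

end Literature.Geometry.Kaehler
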